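import Summits.ResolutionOfSingularities.ResolutionOfSingularities.Theorems.WildConesCampaignW46HypersurfacesCharTwoSatelliteExists

/-!
# [OURS · L1 W4.6, rung (ii) at p = 2, EVERY dimension n] CUBIC POLARIZATION IN CHARACTERISTIC TWO and
# the UNCONDITIONAL near-point count at corank two: `a₃(v + λ) = a₃(v) + polar(λ, v) + polar(v, λ) + a₃(λ)`;
# over every field of characteristic 2 other than `𝔽₂` the value-wise vanishing of the tangent cubic on the
# kernel plane is form-wise; hence `h₂ ≤ 2` ⇒ AT MOST THREE infinitely-near double points, over EVERY
# field of characteristic 2 (no value hypothesis) — `z² = a(u₁,…,uₙ)`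

HONEST FRAMING. Everything here is OURS: theorems about route WildCones' own TYPED point-blow-up dynamics
(`Theorems/WildConesClassicalRegimesDefs.lean`) and the seat's invariants `polarMatrix` (p502936),
`milnorEmbDim` (p498937), `milnorHilbertTwo` (p511581), `degForm` (p522667). NOTHING here is a statement
of the manuscript [Hironaka2017]; no FACT-LIST premise; AI review is weaker than expert review. Cell
res-hironaka (LADDER-RESOLUTION rung L, D-0089), slot W4.6, seat res-L1-s46-pv-4 (gen 6); host route
`WildCones`, crux `ClassicalRegimes` (stmt-ResolutionOfSingularities-16884; proved).

WHY. Gen 5 counted the infinitely-near double points of an isolated corank-two double point: AT MOST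
THREE provided some kernel VALUE `a₃(v) ≠ 0` (p525636), and linked `h₂ ≤ 2` to the FORM-wise condition
«some polar of `a₃` is non-zero on the kernel» (p531822), noting that over `𝔽₂` the two differ (the
non-zero binary cubic `st(s+t)` vanishes at the three rational points of `ℙ¹(𝔽₂)`). THIS FILE closes the
gap: (1) the cubic polarization identity in characteristic two,
`a₃(v + λ) = a₃(v) + Σₛ λₛ(∂ₛa)₂(v) + Σₛ vₛ(∂ₛa)₂(λ) + a₃(λ)` (from Euler `a₃(w) = polar(w, w)`,
quadratic polarization p536239 and `D_wD_w a = 0`), so along a line `a₃(u + xv)` is the cubic polynomial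
`a₃(u) + x·polar(v,u) + x²·polar(u,v) + x³·a₃(v)`; (2) over a field with MORE THAN THREE elements (every
field of characteristic two except `𝔽₂`) a cubic polynomial vanishing identically is zero, so value-wise
vanishing of `a₃` on the kernel kills all polars there: `h₂ = 3`; contrapositively `h₂ ≤ 2` gives a kernel
value `a₃(v) ≠ 0` and gen 5's count applies; (3) over `𝔽₂` (every element is `0` or `1`) the kernel
plane has exactly three non-zero vectors, so the count `≤ 3` holds trivially. CONCLUSION: for an isolated
corank-two double point with `h₂ ≤ 2` there are AT MOST THREE infinitely-near double points, over every
field of characteristic two; at `h₂ = 1` all of them are free (successor `μ = 1`, no double point after).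

WHAT IS PROVED (every `n`, every field of characteristic `2`):

* `degForm_three_add`, `degForm_three_add_smul` — cubic polarization / the cubic along a line;
* `cubic_coeffs_eq_zero` — a cubic polynomial vanishing at more than three points has zero coefficients;
* `polar_eq_zero_of_cubic_values_eq_zero` — (> 3 field elements) `a₃ ≡ 0` on `ker P` value-wise ⇒ all
  polars vanish on `ker P`; `hypersurface_milnorHilbertTwo_eq_three_of_cubic_values` — ⇒ `h₂ = 3` at
  corank two; `hypersurface_exists_kernel_cubic_ne_zero` — `h₂ ≤ 2` ⇒ a kernel value `a₃(v) ≠ 0`;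
* `charTwo_field_dichotomy` — a field of characteristic two has more than three elements or is `{0, 1}`;
* `hypersurface_nearPoints_le_three_of_milnorHilbertTwo_le_two` — **isolated, `e = 2`, `h₂ ≤ 2` ⇒ at
  most THREE near double points** (a set `S` of `≤ 3` vectors of which every near vector is a multiple),
  NO value hypothesis; `hypersurface_near_census_of_milnorHilbertTwo_eq_one` — the `D₄` line of the
  census: `≤ 3` near double points, each FREE (corank `0`, isolated, `μ = 1`, no double point after it).

References: [CasasAlvero2000] §3 (free/satellite points: context only); [GreuelPfister2026] (context);
[Hironaka2017] Th. 16.6 p.84 — role replaced only, under adjudication; nothing of it is used.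
-/

noncomputable section

-- single-problem summit: the doubled namespace component `ResolutionOfSingularities` is forced
set_option linter.dupNamespace false

open scoped BigOperators Classical

open MvPowerSeries IsLocalRing

open Literature.AlgebraicGeometry.Resolution

namespace Summit.ResolutionOfSingularities.ResolutionOfSingularities.Theorems

namespace CampaignW46.HypersurfacesCharTwo

open WildCones WildCones.MuDropCharTwoOrdP ThreefoldsCharTwo

variable {κ : Type} [Field κ] {n : ℕ}

/-! ## Cubic polarization in characteristic two -/

/-- [OURS · L1 W4.6] The linear form of `∂ₜ D_w f` is `Σₗ wₗ · (∂ₜ∂ₗ f)₁`. [folklore] -/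
theorem degForm_one_pderiv_sum_C_mul_pderiv (f : MvPowerSeries (Fin n) κ) (w x : Fin n → κ) (t : Fin n) :
    degForm 1 (MvPowerSeries.pderiv t (∑ l, C (w l) * MvPowerSeries.pderiv l f)) x =
      ∑ l, w l * degForm 1 (MvPowerSeries.pderiv t (MvPowerSeries.pderiv l f)) x := by
  rw [map_sum, degForm_sum]
  refine Finset.sum_congr rfl fun l _ => ?_
  rw [Derivation.leibniz, pderiv_C, smul_zero, add_zero, smul_eq_mul, degForm_C_mul]

/-- [OURS · L1 W4.6] Characteristic two: `Σₛ vₛ Σₜ vₜ (∂ₜ∂ₛ f)₁(x) = 0` (`D_vD_v f = 0`, p536239).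
[folklore] -/
theorem sum_sum_pderiv_pderiv_self_eq_zero [CharP κ 2] (f : MvPowerSeries (Fin n) κ) (v x : Fin n → κ) :
    ∑ s, v s * ∑ t, v t * degForm 1 (MvPowerSeries.pderiv t (MvPowerSeries.pderiv s f)) x = 0 := by
  refine Eq.trans (Finset.sum_congr rfl fun s _ => ?_) (polarCross_self_eq_zero f v x)
  rw [degForm_one_pderiv_sum_C_mul_pderiv]
  congr 1
  refine Finset.sum_congr rfl fun t _ => ?_
  rw [pderiv_comm t s f]

/-- [OURS · L1 W4.6] Characteristic two: `Σₛ v'ₛ Σₜ vₜ (∂ₜ∂ₛ f)₁(v') = 0` (symmetry of the trilinear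
form and `T(v', v', ·) = 0`, p536239 / p538084). [folklore] -/
theorem sum_sum_pderiv_pderiv_mixed_eq_zero [CharP κ 2] (f : MvPowerSeries (Fin n) κ) (v v' : Fin n → κ) :
    ∑ s, v' s * ∑ t, v t * degForm 1 (MvPowerSeries.pderiv t (MvPowerSeries.pderiv s f)) v' = 0 := by
  have h := polarCross_mixed_eq_zero f v v'
  rw [← polarCross_comm f v v' v'] at h
  refine Eq.trans (Finset.sum_congr rfl fun s _ => ?_) h
  rw [degForm_one_pderiv_sum_C_mul_pderiv]
  congr 1
  refine Finset.sum_congr rfl fun t _ => ?_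
  rw [pderiv_comm t s f]

/-- [OURS · L1 W4.6] **CUBIC POLARIZATION IN CHARACTERISTIC TWO**: for every `f ∈ κ⟦X₁,…,Xₙ⟧` and
vectors `v, v'`,
`degForm 3 f (v + v') = degForm 3 f v + Σₛ v'ₛ·(∂ₛf)₂(v) + Σₛ vₛ·(∂ₛf)₂(v') + degForm 3 f v'`
(Euler `f₃(w) = Σₛ wₛ (∂ₛf)₂(w)` in characteristic two, quadratic polarization of each `(∂ₛf)₂`, and the
two cross terms vanish: `D_vD_v f = 0`). [folklore] -/
theorem degForm_three_add [CharP κ 2] (f : MvPowerSeries (Fin n) κ) (v v' : Fin n → κ) :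
    degForm 3 f (v + v') = degForm 3 f v + ∑ s, v' s * degForm 2 (MvPowerSeries.pderiv s f) v +
      ∑ s, v s * degForm 2 (MvPowerSeries.pderiv s f) v' + degForm 3 f v' := by
  have hZ1 := sum_sum_pderiv_pderiv_self_eq_zero f v v'
  have hZ2 := sum_sum_pderiv_pderiv_mixed_eq_zero f v v'
  have key : ∀ s, degForm 2 (MvPowerSeries.pderiv s f) (v + v') =
      degForm 2 (MvPowerSeries.pderiv s f) v + degForm 2 (MvPowerSeries.pderiv s f) v' +
        ∑ t, v t * degForm 1 (MvPowerSeries.pderiv t (MvPowerSeries.pderiv s f)) v' :=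
    fun s => degForm_two_add _ v v'
  rw [degForm_three_eq_polar_self, degForm_three_eq_polar_self f v, degForm_three_eq_polar_self f v']
  simp only [key, Pi.add_apply, add_mul, mul_add, Finset.sum_add_distrib]
  linear_combination hZ1 + hZ2

/-- [OURS · L1 W4.6] **THE TANGENT CUBIC ALONG A LINE** (characteristic two):
`degForm 3 f (u + x·v) = f₃(u) + x·Σₛ vₛ(∂ₛf)₂(u) + x²·Σₛ uₛ(∂ₛf)₂(v) + x³·f₃(v)` — a cubic
polynomial in `x` whose middle coefficients are the two POLARS. [folklore] -/
theorem degForm_three_add_smul [CharP κ 2] (f : MvPowerSeries (Fin n) κ) (u v : Fin n → κ) (x : κ) :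
    degForm 3 f (u + x • v) = degForm 3 f u + x * ∑ s, v s * degForm 2 (MvPowerSeries.pderiv s f) u +
      x ^ 2 * ∑ s, u s * degForm 2 (MvPowerSeries.pderiv s f) v + x ^ 3 * degForm 3 f v := by
  rw [degForm_three_add, degForm_smul_vec]
  have h1 : ∑ s, (x • v) s * degForm 2 (MvPowerSeries.pderiv s f) u =
      x * ∑ s, v s * degForm 2 (MvPowerSeries.pderiv s f) u := by
    rw [Finset.mul_sum]
    refine Finset.sum_congr rfl fun s _ => ?_
    rw [Pi.smul_apply, smul_eq_mul, mul_assoc]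
  have h2 : ∑ s, u s * degForm 2 (MvPowerSeries.pderiv s f) (x • v) =
      x ^ 2 * ∑ s, u s * degForm 2 (MvPowerSeries.pderiv s f) v := by
    rw [Finset.mul_sum]
    refine Finset.sum_congr rfl fun s _ => ?_
    rw [degForm_smul_vec]
    ring
  rw [h1, h2]

/-! ## A cubic polynomial with more than three roots vanishes -/

/-- [OURS · L1 W4.6] **Four roots kill a cubic**: if `a₀ + a₁x + a₂x² + a₃x³ = 0` for all `x` in a set
of more than three field elements, then `a₀ = a₁ = a₂ = a₃ = 0`. [folklore] -/
theorem cubic_coeffs_eq_zero {a₀ a₁ a₂ a₃ : κ} (s : Finset κ) (hs : 3 < s.card)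
    (h : ∀ x ∈ s, a₀ + x * a₁ + x ^ 2 * a₂ + x ^ 3 * a₃ = 0) :
    a₀ = 0 ∧ a₁ = 0 ∧ a₂ = 0 ∧ a₃ = 0 := by
  set P : Polynomial κ := Polynomial.C a₃ * Polynomial.X ^ 3 + Polynomial.C a₂ * Polynomial.X ^ 2 +
    Polynomial.C a₁ * Polynomial.X + Polynomial.C a₀ with hP
  have hdeg : P.natDegree ≤ 3 := Polynomial.natDegree_cubic_le
  have heval : ∀ x ∈ s, P.eval x = 0 := by
    intro x hx
    rw [← h x hx, hP]
    simp only [Polynomial.eval_add, Polynomial.eval_mul, Polynomial.eval_C, Polynomial.eval_pow,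
      Polynomial.eval_X]
    ring
  have hP0 : P = 0 := Polynomial.eq_zero_of_natDegree_lt_card_of_eval_eq_zero' P s heval (by omega)
  have hc : ∀ k, P.coeff k = 0 := fun k => by rw [hP0, Polynomial.coeff_zero]
  have h0 := hc 0
  have h1 := hc 1
  have h2 := hc 2
  have h3 := hc 3
  simp only [hP, Polynomial.coeff_add, Polynomial.coeff_C_mul, Polynomial.coeff_X_pow, Polynomial.coeff_X,
    Polynomial.coeff_C] at h0 h1 h2 h3
  norm_num at h0 h1 h2 h3
  exact ⟨h0, h1, h2, h3⟩

/-! ## Value-wise vanishing on the kernel is form-wise, outside `𝔽₂` -/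

/-- [OURS · L1 W4.6 rung (ii) at `p = 2`, every dimension; NOT a statement of the manuscript] **OVER A
FIELD WITH MORE THAN THREE ELEMENTS, IF THE TANGENT CUBIC VANISHES AT EVERY KERNEL VECTOR THEN ALL ITS
POLARS VANISH ON THE KERNEL**: for any series `f` (characteristic two), if `degForm 3 f w = 0` for all
`w` with `w·P = 0`, then `Σₛ λₛ (∂ₛf)₂(v) = 0` for all kernel `λ, v` — the cubic polynomial
`x ↦ f₃(v + xλ)` vanishes identically, so its `x`-coefficient `polar(λ, v)` is zero. (Over `𝔽₂` this
fails: `st(s+t)`.) [folklore] -/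
theorem polar_eq_zero_of_cubic_values_eq_zero [CharP κ 2] (hκ : ∃ s : Finset κ, 3 < s.card)
    (f : MvPowerSeries (Fin n) κ)
    (hval : ∀ w : Fin n → κ, Matrix.vecMul w (polarMatrix f) = 0 → degForm 3 f w = 0)
    {lam v : Fin n → κ} (hlam : Matrix.vecMul lam (polarMatrix f) = 0)
    (hv : Matrix.vecMul v (polarMatrix f) = 0) :
    ∑ s, lam s * degForm 2 (MvPowerSeries.pderiv s f) v = 0 := by
  obtain ⟨s, hs⟩ := hκ
  have h : ∀ x ∈ s, degForm 3 f v + x * ∑ t, lam t * degForm 2 (MvPowerSeries.pderiv t f) v +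
      x ^ 2 * ∑ t, v t * degForm 2 (MvPowerSeries.pderiv t f) lam + x ^ 3 * degForm 3 f lam = 0 := by
    intro x _
    rw [← degForm_three_add_smul]
    refine hval _ ?_
    rw [Matrix.add_vecMul, Matrix.smul_vecMul, hv, hlam, smul_zero, add_zero]
  exact (cubic_coeffs_eq_zero s hs h).2.1

/-- [OURS · L1 W4.6 rung (ii) at `p = 2`, every dimension; NOT a statement of the manuscript] **VALUE-WISE
VANISHING OF THE TANGENT CUBIC ON THE KERNEL FORCES `h₂ = 3`, outside `𝔽₂`**: for a double state of
`z² = a(u₁,…,uₙ)` over a field of characteristic two with more than three elements, with `e(c) = 2`: if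
`a₃(w) = 0` for every kernel vector `w`, then `h₂(c) = 3` (all polars vanish, p531822) — the «no tangent
cubic» class, whose double successors are all non-isolated (gen 4). [folklore] -/
theorem hypersurface_milnorHilbertTwo_eq_three_of_cubic_values [CharP κ 2] (hκ : ∃ s : Finset κ, 3 < s.card)
    (c : (Fin n → ℕ) → κ) (hM : MultP 2 n κ c) (he : milnorEmbDim 2 n κ c = 2)
    (hval : ∀ w : Fin n → κ, Matrix.vecMul w (polarMatrix (ser 2 n κ c)) = 0 →
      degForm 3 (ser 2 n κ c) w = 0) :
    milnorHilbertTwo 2 n κ c = 3 :=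
  hypersurface_milnorHilbertTwo_eq_three_of_polar_eq_zero c hM he fun _ _ hlam hv =>
    polar_eq_zero_of_cubic_values_eq_zero hκ _ hval hlam hv

/-- [OURS · L1 W4.6 rung (ii) at `p = 2`, every dimension; NOT a statement of the manuscript] **`h₂ ≤ 2`
GIVES A KERNEL VALUE `a₃(v) ≠ 0`, outside `𝔽₂`**: corank-two double state over a field of characteristic
two with more than three elements, `h₂(c) ≤ 2` ⇒ some kernel vector `v` has `a₃(v) ≠ 0` — so gen 5's
count (p525636: at most three near double points) applies. [folklore] -/
theorem hypersurface_exists_kernel_cubic_ne_zero [CharP κ 2] (hκ : ∃ s : Finset κ, 3 < s.card)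
    (c : (Fin n → ℕ) → κ) (hM : MultP 2 n κ c) (he : milnorEmbDim 2 n κ c = 2)
    (hh : milnorHilbertTwo 2 n κ c ≤ 2) :
    ∃ v : Fin n → κ, Matrix.vecMul v (polarMatrix (ser 2 n κ c)) = 0 ∧ degForm 3 (ser 2 n κ c) v ≠ 0 := by
  by_contra h
  push Not at h
  have h3 := hypersurface_milnorHilbertTwo_eq_three_of_cubic_values hκ c hM he h
  omega

/-! ## The near-point count at `h₂ ≤ 2`, over every field of characteristic two -/

/-- [OURS · L1 W4.6] **A field of characteristic two has more than three elements, or every element is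
`0` or `1`** (`ω ∉ {0,1}` gives the four distinct elements `0, 1, ω, ω + 1`). [folklore] -/
theorem charTwo_field_dichotomy [CharP κ 2] : (∃ s : Finset κ, 3 < s.card) ∨ ∀ x : κ, x = 0 ∨ x = 1 := by
  by_cases h : ∀ x : κ, x = 0 ∨ x = 1
  · exact Or.inr h
  · push Not at h
    obtain ⟨ω, hω0, hω1⟩ := h
    refine Or.inl ⟨{0, 1, ω, ω + 1}, ?_⟩
    have h10 : (1 : κ) ≠ 0 := one_ne_zero
    have hω10 : ω + 1 ≠ 0 := fun h' => hω1 (by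
      have := CharTwo.add_self_eq_zero (1 : κ)
      linear_combination h' - this)
    have hω11 : ω + 1 ≠ 1 := fun h' => hω0 (by linear_combination h')
    have hω1ω : ω + 1 ≠ ω := fun h' => h10 (by linear_combination h')
    have hA : (1 : κ) ∉ ({ω, ω + 1} : Finset κ) := by
      simp only [Finset.mem_insert, Finset.mem_singleton, not_or]
      exact ⟨fun h' => hω1 h'.symm, fun h' => hω11 h'.symm⟩
    have hB : (0 : κ) ∉ ({1, ω, ω + 1} : Finset κ) := by
      simp only [Finset.mem_insert, Finset.mem_singleton, not_or]
      exact ⟨fun h' => h10 h'.symm, fun h' => hω0 h'.symm, fun h' => hω10 h'.symm⟩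
    rw [Finset.card_insert_of_notMem hB, Finset.card_insert_of_notMem hA, Finset.card_pair (Ne.symm hω1ω)]
    norm_num

/-- [OURS · L1 W4.6 rung (ii) at `p = 2`, EVERY dimension `n`, EVERY field of characteristic `2`; NOT a
statement of the manuscript] **AT `h₂ ≤ 2` AN ISOLATED CORANK-TWO DOUBLE POINT HAS AT MOST THREE
INFINITELY-NEAR DOUBLE POINTS** — no value hypothesis: for an isolated double state of
`z² = a(u₁,…,uₙ)` with `e(c) = 2` and `h₂(c) ≤ 2` there is a set `S` of AT MOST THREE vectors such that
the near vector `w = (τ with w_i = 1)` of every chart and translation `(i, τ)` with a double successor is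
a multiple of a member of `S` (at most three points of the kernel line `ℙ(ker P)`). Outside `𝔽₂` a kernel
value `a₃(v) ≠ 0` exists (above) and p525636 counts the roots; over `𝔽₂` the kernel plane has just three
non-zero vectors. By gen 4 all these successors are isolated with smaller `μ`. [folklore] -/
theorem hypersurface_nearPoints_le_three_of_milnorHilbertTwo_le_two [CharP κ 2] (c : (Fin n → ℕ) → κ)
    (hM : MultP 2 n κ c) (hI : Isol 2 n κ c) (he : milnorEmbDim 2 n κ c = 2)
    (hh : milnorHilbertTwo 2 n κ c ≤ 2) :
    ∃ S : Finset (Fin n → κ), S.card ≤ 3 ∧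
      ∀ (i : Fin n) (τ : Fin n → κ), MultP 2 n κ (step 2 n κ i τ c) →
        ∃ w ∈ S, ∃ r : κ, Function.update τ i 1 = r • w := by
  rcases charTwo_field_dichotomy (κ := κ) with hκ | h01
  · exact hypersurface_nearPoints_le_three c hM hI he (hypersurface_exists_kernel_cubic_ne_zero hκ c hM he hh)
  · -- over `𝔽₂`: a kernel basis `v₁, v₂`; every non-zero kernel vector is `v₁`, `v₂` or `v₁ + v₂`
    obtain ⟨lam, v, hlam, -, hne⟩ := (hypersurface_milnorHilbertTwo_le_two_iff_polar c hM he).mp hh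
    have hlam0 : lam ≠ 0 := by
      intro h0
      apply hne
      exact Finset.sum_eq_zero fun s _ => by rw [h0, Pi.zero_apply, zero_mul]
    obtain ⟨v₂, hv₂, -, hspan⟩ := exists_kernel_pair hM he hlam0 hlam
    refine ⟨{lam, v₂, lam + v₂}, Finset.card_le_three, fun i τ hM' => ?_⟩
    obtain ⟨hker, -⟩ := hypersurface_ker_and_cubic_of_double_successor c i τ hM hM'
    obtain ⟨a, b, hab⟩ := hspan _ hker
    have hwi : Function.update τ i 1 i = 1 := Function.update_self ..
    rcases h01 a with ha | ha <;> rcases h01 b with hb | hb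
    · -- `w = 0`: impossible
      exfalso
      rw [ha, hb, zero_smul, zero_smul, add_zero] at hab
      have h := congrFun hab i
      rw [hwi, Pi.zero_apply] at h
      exact zero_ne_one h
    · refine ⟨v₂, by simp, 1, ?_⟩
      rw [← hab, ha, hb, zero_smul, one_smul, zero_add]
    · refine ⟨lam, by simp, 1, ?_⟩
      rw [← hab, ha, hb, zero_smul, one_smul, add_zero]
    · refine ⟨lam + v₂, by simp, 1, ?_⟩
      rw [← hab, ha, hb, one_smul, one_smul, one_smul]

/-- [OURS · L1 W4.6 rung (ii) at `p = 2`, EVERY dimension `n`, EVERY field of characteristic `2`; NOT a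
statement of the manuscript] **THE `D₄` LINE OF THE CENSUS**: an isolated double state of
`z² = a(u₁,…,uₙ)` with `e(c) = 2`, `h₂(c) = 1` (three distinct tangents; `μ = 4`, p517564) has AT MOST
THREE infinitely-near double points, and EACH of them is FREE: an isolated double point of corank `0`
with `μ = 1`, after which no double point follows (gen 4, p513980). The whole tree of infinitely-near
double points above `c` under point blow-ups is: the root and at most three leaves. [folklore] -/
theorem hypersurface_near_census_of_milnorHilbertTwo_eq_one [CharP κ 2] (c : (Fin n → ℕ) → κ)
    (hM : MultP 2 n κ c) (hI : Isol 2 n κ c) (he : milnorEmbDim 2 n κ c = 2)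
    (hh : milnorHilbertTwo 2 n κ c = 1) :
    (∃ S : Finset (Fin n → κ), S.card ≤ 3 ∧
      ∀ (i : Fin n) (τ : Fin n → κ), MultP 2 n κ (step 2 n κ i τ c) →
        ∃ w ∈ S, ∃ r : κ, Function.update τ i 1 = r • w) ∧
    ∀ (i : Fin n) (τ : Fin n → κ), MultP 2 n κ (step 2 n κ i τ c) →
      milnorEmbDim 2 n κ (step 2 n κ i τ c) = 0 ∧ Isol 2 n κ (step 2 n κ i τ c) ∧
        mu 2 n κ (step 2 n κ i τ c) = 1 ∧
          ∀ (i' : Fin n) (τ' : Fin n → κ), ¬ MultP 2 n κ (step 2 n κ i' τ' (step 2 n κ i τ c)) := by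
  refine ⟨hypersurface_nearPoints_le_three_of_milnorHilbertTwo_le_two c hM hI he (by omega), fun i τ hM' => ?_⟩
  obtain ⟨he', hI', hμ'⟩ := hypersurface_regime_step_of_milnorHilbertTwo_eq_one c i τ hM he hh hM'
  exact ⟨he', hI', hμ', hypersurface_not_multP_step_step_of_milnorHilbertTwo_eq_one c i τ hM he hh hM'⟩

end CampaignW46.HypersurfacesCharTwo

end Summit.ResolutionOfSingularities.ResolutionOfSingularities.Theorems

end
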